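import Summits.CriticalPhenomena.PercolationContinuityZ3.Theorems.PercAnnulusCrossingIICMultiPointUpper
import HarnessLib

/-!
# Shell volumes of Kesten's IIC at separated scales are quasi-uncorrelated: `E_ν[V_R V_{R'}] ≤ K·E_ν V_R·E_ν V_{R'}` (lane RSW3, p1 gen 19)

builds on p205010 (kernel theorem, internal audit signed; external expert review pending) — NOT used in this file (only `p_c(ℤ^d) > 0`).

RSW3 lane (LANE 3 `prim-rsw3`), seat `prim-rsw3-p1` (gen 19).  Helper file (`--supports stmt-CriticalPhenomena-4575`);
no definitions, no sorries.  Memo `run/shared/lean/prim/rsw3/P1-QM.md` §32.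

The `k = 2` case of gen 19 (8b) (`ν(0 ↔ x, 0 ↔ y) ≤ A C²·π(‖x‖)π(‖y‖)` for `‖y‖ ≥ 8‖x‖ ≥ 32`), summed over the shells
`S_R = Λ(2R) ∖ Λ(R)` and `S_{R'}`, `R' ≥ 16R`, and compared with the two-point lower bound of gen 18 (3) (`c·π(‖x‖) ≤ ν(0 ↔ x)`):

* `integral_card_filter_mul_card_filter_eq_sum` — `∫ #{x ∈ S : ω ∈ A_x}·#{y ∈ S' : ω ∈ B_y} dμ = Σ_{x∈S} Σ_{y∈S'} μ(A_x ∩ B_y)` (any finite measure);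
* `supNorm_single_natCast`, `iicMeasure_real_openConn_inter_openConn_le` — the two-point case of (8b), padded to the all-scales hypotheses;
* **`exists_integral_shellVolume_mul_le_criticalProbI`** — (A2)□(s,L) + `CU⁺_l` + UAD at `p_c(ℤ^d)`, `d ≥ 2`: there are `R₀` and `K` such that for every
  IIC measure `ν`, all `R ≥ R₀` and `R' ≥ 16R`, with `V_R = |C(0) ∩ (Λ(2R) ∖ Λ(R))|`:
  **`E_ν[V_R · V_{R'}] ≤ K · E_ν[V_R] · E_ν[V_{R'}]`** — THE VOLUMES OF THE IIC IN SHELLS AT SEPARATED SCALES ARE QUASI-UNCORRELATED (the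
  second-moment input for laws of large numbers along scales; cf. gen 14's a.s. constancy of the growth rates, which used tail triviality only).
References: H. Kesten, Probab. Theory Relat. Fields 73 (1986), Thm. (8) and (3.13); A. Járai, Ann. Probab. 31 (2003), §3.
-/

noncomputable section

namespace Summit.CriticalPhenomena.PercolationContinuityZ3.Theorems.Crossing

open MeasureTheory Filter Topology Literature.Probability.Percolation Literature.Probability.LatticeModels
open Literature.Probability.Percolation.DCT16
open Summit.CriticalPhenomena.PercolationContinuityZ3.Theorems.SurfaceTension

variable {d : ℕ}

/-! ## §1 The mixed second moment of two counts -/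

open Classical in
/-- **`∫ #{x ∈ S : ω ∈ A_x} · #{y ∈ S' : ω ∈ B_y} dμ = Σ_{x ∈ S} Σ_{y ∈ S'} μ(A_x ∩ B_y)`** for a finite measure and measurable events (expand both counts as
sums of indicators). [cite: Kesten1986, Thm. (8), (43)] -/
theorem integral_card_filter_mul_card_filter_eq_sum {Ω ι : Type*} [MeasurableSpace Ω] (μ : Measure Ω) [IsFiniteMeasure μ]
    (S S' : Finset ι) (A B : ι → Set Ω) (hA : ∀ x ∈ S, MeasurableSet (A x)) (hB : ∀ y ∈ S', MeasurableSet (B y)) :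
    ∫ ω, (((S.filter fun x => ω ∈ A x).card : ℕ) : ℝ) * (((S'.filter fun y => ω ∈ B y).card : ℕ) : ℝ) ∂μ =
      ∑ x ∈ S, ∑ y ∈ S', μ.real (A x ∩ B y) := by
  have hpt : ∀ ω, (((S.filter fun x => ω ∈ A x).card : ℕ) : ℝ) * (((S'.filter fun y => ω ∈ B y).card : ℕ) : ℝ) =
      ∑ x ∈ S, ∑ y ∈ S', (A x ∩ B y).indicator (1 : Ω → ℝ) ω := by
    intro ω
    have h1 : (((S.filter fun x => ω ∈ A x).card : ℕ) : ℝ) = ∑ x ∈ S, (A x).indicator (1 : Ω → ℝ) ω := by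
      rw [Finset.card_filter]; push_cast
      refine Finset.sum_congr rfl fun x _ => ?_
      by_cases h : ω ∈ A x <;> simp [h]
    have h2 : (((S'.filter fun y => ω ∈ B y).card : ℕ) : ℝ) = ∑ y ∈ S', (B y).indicator (1 : Ω → ℝ) ω := by
      rw [Finset.card_filter]; push_cast
      refine Finset.sum_congr rfl fun y _ => ?_
      by_cases h : ω ∈ B y <;> simp [h]
    rw [h1, h2, Finset.sum_mul_sum]
    refine Finset.sum_congr rfl fun x _ => Finset.sum_congr rfl fun y _ => ?_
    rw [Set.inter_indicator_one]
    rfl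
  simp_rw [hpt]
  rw [integral_finsetSum]
  · refine Finset.sum_congr rfl fun x hx => ?_
    rw [integral_finsetSum]
    · exact Finset.sum_congr rfl fun y hy => integral_indicator_one ((hA x hx).inter (hB y hy))
    · intro y hy
      exact (integrable_const (1 : ℝ)).indicator ((hA x hx).inter (hB y hy))
  · intro x hx
    exact integrable_finsetSum _ fun y hy => (integrable_const (1 : ℝ)).indicator ((hA x hx).inter (hB y hy))

/-! ## §2 The two-point case of the multipoint upper bound -/

/-- `‖m·e_0‖_∞ = m` on `ℤ^d`, `d ≥ 1`. [folklore] -/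
theorem supNorm_single_natCast (hd : 1 ≤ d) (m : ℕ) : Site.supNorm (Pi.single (⟨0, hd⟩ : Fin d) (m : ℤ) : Site d) = m := by
  apply le_antisymm
  · rw [Site.supNorm_le_iff]
    intro j
    by_cases hj : j = ⟨0, hd⟩
    · subst hj; simp
    · rw [Pi.single_eq_of_ne hj]; simp
  · have h := Site.natAbs_le_supNorm (Pi.single (⟨0, hd⟩ : Fin d) (m : ℤ) : Site d) ⟨0, hd⟩
    simpa using h

/-- **THE TWO-POINT CASE OF GEN 19 (8b)**: (A2)□(s,L) at `p_c(ℤ^d)`, `d ≥ 2`: with the constants `A, C` of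
`exists_iicMeasure_real_biInter_openConn_le_criticalProbI`, for every IIC measure `ν` and all sites with `‖x‖_∞ ≥ 4`, `‖y‖_∞ ≥ 8‖x‖_∞`:
**`ν(0 ↔ x, 0 ↔ y) ≤ A·C²·π_{p_c}(‖x‖_∞)·π_{p_c}(‖y‖_∞)`** (pad the two scales by the geometric sequence `‖y‖·8^j` and the sites `‖y‖8^j·e_0`).
[cite: Kesten1986, Thm. (8)] -/
theorem iicMeasure_real_openConn_inter_openConn_le (hd : 2 ≤ d) {A C : ℝ}
    (hAC : ∀ (ν : Measure (BondConfig (Site d))) [IsFiniteMeasure ν],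
      (∀ (F : Finset (Sym2 (Site d))) (E : Set (BondConfig (Site d))), MeasurableSet E → DeterminedBy E ↑F →
        Tendsto (fun n : ℕ => (bondPercolation (zdGraph d) (criticalProbI d)).real (E ∩ siteToBoundary d n) /
          oneArmProb d (criticalProbI d) n) atTop (𝓝 (ν.real E))) →
      ∀ (n : ℕ → ℕ), 4 ≤ n 0 → (∀ i, 8 * n i ≤ n (i + 1)) → ∀ (z : ℕ → Site d), (∀ i, z i ∈ sphere d (n i)) →
        ∀ k : ℕ, 1 ≤ k →
          ν.real (⋂ i ∈ Finset.range k, (openConn (0 : Site d) (z i) : Set (BondConfig (Site d)))) ≤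
            A * C ^ k * ∏ i ∈ Finset.range k, oneArmProb d (criticalProbI d) (n i))
    {ν : Measure (BondConfig (Site d))} [IsFiniteMeasure ν]
    (hν : ∀ (F : Finset (Sym2 (Site d))) (E : Set (BondConfig (Site d))), MeasurableSet E → DeterminedBy E ↑F →
      Tendsto (fun n : ℕ => (bondPercolation (zdGraph d) (criticalProbI d)).real (E ∩ siteToBoundary d n) /
        oneArmProb d (criticalProbI d) n) atTop (𝓝 (ν.real E)))
    {x y : Site d} (hx : 4 ≤ Site.supNorm x) (hxy : 8 * Site.supNorm x ≤ Site.supNorm y) :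
    ν.real ((openConn (0 : Site d) x : Set (BondConfig (Site d))) ∩ openConn (0 : Site d) y) ≤
      A * C ^ 2 * (oneArmProb d (criticalProbI d) (Site.supNorm x) * oneArmProb d (criticalProbI d) (Site.supNorm y)) := by
  have hd1 : 1 ≤ d := le_trans (by norm_num) hd
  -- padded scales and sites
  set n : ℕ → ℕ := fun i => if i = 0 then Site.supNorm x else Site.supNorm y * 8 ^ (i - 1) with hn
  set z : ℕ → Site d := fun i => if i = 0 then x else if i = 1 then y else Pi.single (⟨0, hd1⟩ : Fin d) ((Site.supNorm y * 8 ^ (i - 1) : ℕ) : ℤ)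
    with hz
  have hn0 : n 0 = Site.supNorm x := by simp [hn]
  have hn1 : ∀ i, n (i + 1) = Site.supNorm y * 8 ^ i := fun i => by simp [hn]
  have hz0 : z 0 = x := by simp [hz]
  have hz1 : z 1 = y := by simp [hz]
  have hz2 : ∀ j, z (j + 2) = Pi.single (⟨0, hd1⟩ : Fin d) ((Site.supNorm y * 8 ^ (j + 1) : ℕ) : ℤ) := fun j => by
    simp [hz]
  have hgrow : ∀ i, 8 * n i ≤ n (i + 1) := by
    intro i
    cases i with
    | zero => rw [hn0, hn1, pow_zero, mul_one]; exact hxy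
    | succ j => rw [hn1, hn1, pow_succ]; exact le_of_eq (by ring)
  have hsph : ∀ i, z i ∈ sphere d (n i) := by
    intro i
    match i with
    | 0 => rw [hz0, hn0]; exact self_mem_sphere x
    | 1 => rw [hz1, hn1, pow_zero, mul_one]; exact self_mem_sphere y
    | j + 2 => rw [hz2, hn1 (j + 1), mem_sphere, supNorm_single_natCast hd1]
  have h := hAC ν hν n (by rw [hn0]; exact hx) hgrow z hsph (1 + 1) (by norm_num)
  have hset : (⋂ i ∈ Finset.range (1 + 1), (openConn (0 : Site d) (z i) : Set (BondConfig (Site d)))) =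
      (openConn (0 : Site d) x : Set (BondConfig (Site d))) ∩ openConn (0 : Site d) y := by
    rw [Finset.range_add_one, Finset.set_biInter_insert, Finset.range_one, Finset.set_biInter_singleton, hz0, hz1, Set.inter_comm]
  have hprod : ∏ i ∈ Finset.range (1 + 1), oneArmProb d (criticalProbI d) (n i) =
      oneArmProb d (criticalProbI d) (Site.supNorm x) * oneArmProb d (criticalProbI d) (Site.supNorm y) := by
    rw [Finset.prod_range_succ, Finset.prod_range_one, hn0, hn1, pow_zero, mul_one]
  rw [hset, hprod] at h
  exact h

/-! ## §3 Shell volumes at separated scales are quasi-uncorrelated -/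

open Classical in
/-- **SHELL VOLUMES OF KESTEN'S IIC AT SEPARATED SCALES ARE QUASI-UNCORRELATED** (`p_c(ℤ^d)`, `d ≥ 2`; (A2)□ at aspect `(s,L)`, `2 ≤ s ≤ L`,
`ϰ > 0`; `CU⁺_l(c_U)`, `l ≥ 2`, `c_U > 0`; UAD): there are `R₀` and `K > 0` such that for every finite measure `ν` with Kesten's IIC limit property,
all `R ≥ R₀` and all `R' ≥ 16R`, with `V_R(ω) = #{x ∈ Λ(2R) ∖ Λ(R) : 0 ↔ x}`:
**`E_ν[V_R · V_{R'}] ≤ K · E_ν[V_R] · E_ν[V_{R'}]`**.  (Upper bound on each `ν(0 ↔ x, 0 ↔ y)` by gen 19 (8b) with `k = 2`; lower bound on each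
`ν(0 ↔ x)` by gen 18 (3).) [cite: Kesten1986, Thm. (8)] [cite: BasuSapozhnikov2017ECP, Thm. 1.1] -/
theorem exists_integral_shellVolume_mul_le_criticalProbI (hd : 2 ≤ d) {s L : ℕ} (hs : 2 ≤ s) (hsL : s ≤ L) {ϰ : ℝ} (hϰ : 0 < ϰ)
    (hA2 : SetToSetQuasiMultAspectAt d (criticalProbI d) s L ϰ) {l : ℕ} (hl : 2 ≤ l) {cU : ℝ} (hcU : 0 < cU)
    (hCU : ∀ a : ℕ, 1 ≤ a → ∀ E : Set (BondConfig (Site d)), IsUpperSet E → MeasurableSet E →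
      cU * (bondPercolation (zdGraph d) (criticalProbI d)).real E ≤ (bondPercolation (zdGraph d) (criticalProbI d)).real (E ∩
        {ω : BondConfig (Site d) | ∀ t ∈ innerBoundary (zdGraph d) (box d a), ∀ s ∈ innerBoundary (zdGraph d) (box d (l * a)),
          ∀ t' ∈ innerBoundary (zdGraph d) (box d a), ∀ s' ∈ innerBoundary (zdGraph d) (box d (l * a)),
          ω ∈ openConnIn (↑((box d (l * a) \ box d a) ∪ innerBoundary (zdGraph d) (box d a)) : Set (Site d)) t s →
          ω ∈ openConnIn (↑((box d (l * a) \ box d a) ∪ innerBoundary (zdGraph d) (box d a)) : Set (Site d)) t' s' →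
          ω ∈ openConnIn (↑((box d (l * a) \ box d a) ∪ innerBoundary (zdGraph d) (box d a)) : Set (Site d)) s s'}))
    (hUAD : ∀ ε : ℝ, 0 < ε → ∃ K₀ : ℕ, ∀ m : ℕ, 1 ≤ m → ∀ N : ℕ, K₀ * m ≤ N →
      (bondPercolation (zdGraph d) (criticalProbI d)).real (boxCrossing d m N) ≤ ε) :
    ∃ (R₀ : ℕ) (K : ℝ), 1 ≤ R₀ ∧ 0 < K ∧ ∀ (ν : Measure (BondConfig (Site d))) [IsFiniteMeasure ν],
      (∀ (F : Finset (Sym2 (Site d))) (E : Set (BondConfig (Site d))), MeasurableSet E → DeterminedBy E ↑F →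
        Tendsto (fun n : ℕ => (bondPercolation (zdGraph d) (criticalProbI d)).real (E ∩ siteToBoundary d n) /
          oneArmProb d (criticalProbI d) n) atTop (𝓝 (ν.real E))) →
      ∀ R R' : ℕ, R₀ ≤ R → 16 * R ≤ R' →
        ∫ ω, ((((box d (2 * R) \ box d R).filter fun x => ω ∈ (openConn (0 : Site d) x : Set (BondConfig (Site d)))).card : ℕ) : ℝ) *
            ((((box d (2 * R') \ box d R').filter fun y => ω ∈ (openConn (0 : Site d) y : Set (BondConfig (Site d)))).card : ℕ) : ℝ) ∂ν ≤
          K * (∫ ω, ((((box d (2 * R) \ box d R).filter fun x => ω ∈ (openConn (0 : Site d) x : Set (BondConfig (Site d)))).card : ℕ) : ℝ) ∂ν) *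
            (∫ ω, ((((box d (2 * R') \ box d R').filter fun y => ω ∈ (openConn (0 : Site d) y : Set (BondConfig (Site d)))).card : ℕ) : ℝ) ∂ν) := by
  obtain ⟨n₀, c, hn₀, hc, hlow⟩ := exists_le_iicMeasure_real_openConn_criticalProbI hd hs hsL hϰ hA2 hl hcU hCU hUAD
  obtain ⟨A, C, hA, hC, hup⟩ := exists_iicMeasure_real_biInter_openConn_le_criticalProbI hd hs hsL hϰ hA2
  refine ⟨max n₀ 4, A * C ^ 2 / c ^ 2, le_trans hn₀ (le_max_left _ _), by positivity, fun ν _ hν R R' hR hR' => ?_⟩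
  have hR4 : 4 ≤ R := le_trans (le_max_right _ _) hR
  have hRn : n₀ ≤ R := le_trans (le_max_left _ _) hR
  set S := box d (2 * R) \ box d R with hS
  set S' := box d (2 * R') \ box d R' with hS'
  set π := fun m => oneArmProb d (criticalProbI d) m with hπ
  have hmS : ∀ x ∈ S, R < Site.supNorm x ∧ Site.supNorm x ≤ 2 * R := by
    intro x hx
    rw [hS, Finset.mem_sdiff, mem_box_iff_supNorm_le, mem_box_iff_supNorm_le] at hx
    omega
  have hmS' : ∀ y ∈ S', R' < Site.supNorm y ∧ Site.supNorm y ≤ 2 * R' := by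
    intro y hy
    rw [hS', Finset.mem_sdiff, mem_box_iff_supNorm_le, mem_box_iff_supNorm_le] at hy
    omega
  -- the mixed moment as a double sum, bounded termwise by (8b) with k = 2
  have hmeas : ∀ w : Site d, MeasurableSet (openConn (0 : Site d) w : Set (BondConfig (Site d))) := fun w => measurableSet_openConn_holds 0 w
  rw [integral_card_filter_mul_card_filter_eq_sum ν S S' _ _ (fun x _ => hmeas x) (fun y _ => hmeas y)]
  have hterm : ∀ x ∈ S, ∀ y ∈ S', ν.real ((openConn (0 : Site d) x : Set (BondConfig (Site d))) ∩ openConn (0 : Site d) y) ≤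
      A * C ^ 2 * (π (Site.supNorm x) * π (Site.supNorm y)) := by
    intro x hx y hy
    have h1 := hmS x hx
    have h2 := hmS' y hy
    exact iicMeasure_real_openConn_inter_openConn_le hd hup hν (by omega) (by omega)
  -- the first moments bounded below by the two-point lower bound
  have hint : ∀ (T : Finset (Site d)), ∫ ω, (((T.filter fun x => ω ∈ (openConn (0 : Site d) x : Set (BondConfig (Site d)))).card : ℕ) : ℝ) ∂ν =
      ∑ x ∈ T, ν.real (openConn (0 : Site d) x) := by
    intro T
    have h := integral_card_filter_mul_card_filter_eq_sum ν T {(0 : Site d)} (fun x => (openConn (0 : Site d) x : Set (BondConfig (Site d))))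
      (fun _ => Set.univ) (fun x _ => hmeas x) (fun _ _ => MeasurableSet.univ)
    simp only [Finset.filter_singleton, Set.mem_univ, if_true, Finset.card_singleton, Nat.cast_one, mul_one, Finset.sum_singleton,
      Set.inter_univ] at h
    exact h
  have hlowS : c * ∑ x ∈ S, π (Site.supNorm x) ≤ ∑ x ∈ S, ν.real (openConn (0 : Site d) x) := by
    rw [Finset.mul_sum]
    exact Finset.sum_le_sum fun x hx => hlow ν hν _ x (by have := hmS x hx; omega) (self_mem_sphere x)
  have hlowS' : c * ∑ y ∈ S', π (Site.supNorm y) ≤ ∑ y ∈ S', ν.real (openConn (0 : Site d) y) := by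
    rw [Finset.mul_sum]
    exact Finset.sum_le_sum fun y hy => hlow ν hν _ y (by have := hmS' y hy; omega) (self_mem_sphere y)
  rw [hint S, hint S']
  have hS0 : 0 ≤ ∑ x ∈ S, π (Site.supNorm x) := Finset.sum_nonneg fun x _ => by simp only [hπ]; unfold oneArmProb; exact measureReal_nonneg
  have hS0' : 0 ≤ ∑ y ∈ S', π (Site.supNorm y) := Finset.sum_nonneg fun y _ => by simp only [hπ]; unfold oneArmProb; exact measureReal_nonneg
  calc ∑ x ∈ S, ∑ y ∈ S', ν.real ((openConn (0 : Site d) x : Set (BondConfig (Site d))) ∩ openConn (0 : Site d) y)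
      ≤ ∑ x ∈ S, ∑ y ∈ S', A * C ^ 2 * (π (Site.supNorm x) * π (Site.supNorm y)) :=
        Finset.sum_le_sum fun x hx => Finset.sum_le_sum fun y hy => hterm x hx y hy
    _ = A * C ^ 2 * ((∑ x ∈ S, π (Site.supNorm x)) * (∑ y ∈ S', π (Site.supNorm y))) := by
        rw [Finset.sum_mul_sum, Finset.mul_sum]
        refine Finset.sum_congr rfl fun x _ => ?_
        rw [Finset.mul_sum]
    _ = A * C ^ 2 / c ^ 2 * ((c * ∑ x ∈ S, π (Site.supNorm x)) * (c * ∑ y ∈ S', π (Site.supNorm y))) := by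
        have hc2 : c ^ 2 ≠ 0 := pow_ne_zero 2 hc.ne'
        calc A * C ^ 2 * ((∑ x ∈ S, π (Site.supNorm x)) * (∑ y ∈ S', π (Site.supNorm y)))
            = A * C ^ 2 * ((∑ x ∈ S, π (Site.supNorm x)) * (∑ y ∈ S', π (Site.supNorm y))) * (c ^ 2 / c ^ 2) := by
              rw [div_self hc2, mul_one]
          _ = A * C ^ 2 / c ^ 2 * ((c * ∑ x ∈ S, π (Site.supNorm x)) * (c * ∑ y ∈ S', π (Site.supNorm y))) := by ring
    _ ≤ A * C ^ 2 / c ^ 2 * ((∑ x ∈ S, ν.real (openConn (0 : Site d) x)) * (∑ y ∈ S', ν.real (openConn (0 : Site d) y))) := by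
        refine mul_le_mul_of_nonneg_left ?_ (by positivity)
        exact mul_le_mul hlowS hlowS' (mul_nonneg hc.le hS0') ((mul_nonneg hc.le hS0).trans hlowS)
    _ = A * C ^ 2 / c ^ 2 * (∑ x ∈ S, ν.real (openConn (0 : Site d) x)) * (∑ y ∈ S', ν.real (openConn (0 : Site d) y)) := by ring

end Summit.CriticalPhenomena.PercolationContinuityZ3.Theorems.Crossing

end
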